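import Summits.NavierStokesRegularity.FunctionalMining.StretchingLaminateSexticEigen
import Summits.NavierStokesRegularity.FunctionalMining.StretchingLaminateCapClaimV2
import Mathlib.Tactic.Linarith
import Mathlib.Tactic.NormNum
import HarnessLib

/-!
# FunctionalMining — K1-Q1 laminates: `C_lam ≤ 1.021188` in the KERNEL (dict seat, staged; binds census-1 A's claim file V2)

search for candidate a priori estimates; no regularity claim.  Three-line bindings; nothing about Navier–Stokes solutions.

THEOREM L-CAP v2 (T6) of bank g5 (`K1Q1-LAMINATE-CAP.md` v2 §2–3; bank's Mathlib-only kernel check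
`LAMCAP-T6-COMBINED.scratch.lean`, 0 hypotheses) as a kernel theorem in the tree architecture: census-1 (A)'s kernel
certificate `LaminateCapV2.polyClaim6_T6` of the T6 polynomial CLAIM (`StretchingLaminateCapClaimV2.lean`,
Mathlib-only, sha256[:16] 81cd9c21ef58db82, 2026-08-20T09:39Z) ∘ the generic sextic pipeline
`Laminate.ratioBound_of_polyClaim6` (dict (an)/(at)/(au)/(av), with bank's blocks verbatim):
**`Laminate.ratioBound_lcap6 : RatioBound (255297/250000)`**, **`Laminate.laminateSupConst_le_lcap6 :
laminateSupConst ≤ 255297/250000 = 1.021188`**, `laminateDeficit_holds6 : LaminateDeficit` (third kernel proof, after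
(as) `9/8` and (ar) `1.077708`).  This caps ONE lower-bound METHOD (finite div-free lamination trees) for the stretching
constant; `C⋆` itself is untouched unless `LaminatesSharp`; the kernel window for `C⋆` stays `(2+√5)/8 ≤ C⋆ < 2/√3`.
search for candidate a priori estimates; no regularity claim.
-/


namespace Summit.NavierStokesRegularity.FunctionalMining

namespace Laminate

/-- census-1 (A)'s kernel claim `LaminateCapV2.polyClaim6_T6`, restated as `PolyClaim6` at bank's T6 multipliers
`θ = 255297/250000`, `a = −249563/500000`, `b = 2431/15625`, `c₆ = 14869951/10¹²`, `(c₂,c₁,c₀) = (10,450,1178)`.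
[ours; bookkeeping] -/
theorem lcapPolyClaim6 :
    PolyClaim6 (255297 / 250000) (-249563 / 500000) (2431 / 15625) (14869951 / 1000000000000) 10 450 1178 := by
  intro m q s hm0 hm1 hq hs hlo hhi
  have h := LaminateCapV2.polyClaim6_T6 m q s hm0 hm1 hq hs hlo hhi
  linarith

/-- **`RatioBound (255297/250000)`** — THEOREM L-CAP v2 (T6) in the kernel. [ours; elementary] -/
theorem ratioBound_lcap6 : RatioBound (255297 / 250000) :=
  ratioBound_of_polyClaim6 (by norm_num) (by norm_num) lcapPolyClaim6

/-- **`C_lam ≤ 255297/250000 = 1.021188`** (bank THEOREM L-CAP v2). [ours; elementary] -/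
theorem laminateSupConst_le_lcap6 : laminateSupConst ≤ 255297 / 250000 :=
  laminateSupConst_le_of_ratioBound ratioBound_lcap6

end Laminate

-- (`LaminateDeficit` is already the tree theorem `Laminate.laminateDeficit_nine_eighths`; the T6 route
-- `255297/250000 < 2/√3` re-derives it and is not restated here — dedup lint.)

end Summit.NavierStokesRegularity.FunctionalMining
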